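import Summits.ResolutionOfSingularities.ResolutionOfSingularities.Theorems.MarkedTransferCampaignW46WWalkSubst
import Literature.AlgebraicGeometry.Resolution.FreeChainApproximatePower
import Literature.RingTheory.MvPowerSeries.MaximalIdealPow
import HarnessLib

/-!
# [OURS · L1 W4.6 rung (iii-2)] THE W-WALK ENDGAME in `K⟦t, y, z⟧`: an infinite tail of `T`-steps forces the generator into
# `(y − ψ_k(t), z − ζ_k(t))^p + 𝔪^{p+k}` for every `k` — against the approximate exit door

Cell `res-hironaka`, LADDER-RESOLUTION rung L (D-0089), slot W4.6 rung (iii); seat res-L1-s46-pv-5 (gen 6), plan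
`HOME/L/res-L1-s46-pv-5/W-WALK-PLAN.md` §2 (endgame) / §3 [G]. Host route MarkedTransfer, `--supports stmt-ResolutionOfSingularities-16155
--as helper`; kind definition (substitution families `stepS`, `compS`, `straightS`, `dilS`, the `t`-polynomials `tpoly`).

WHAT. Formal data of a `T`-tail: generators `g j ∈ K⟦t,y,z⟧` of order `≥ p` with `t^p · g (j+1) = (g j)(t, t(y + l_j), t(z − γ_j t))`
(`stepS`; this is `z^p + f ↦ z^p + stepT p l γ f` of the model, `subst_stepS_generator`). Then (`tPow_mul_eq_subst_compS`)
`t^{kp} · g k = (g 0)(t, t^k y + ψ_k(t), t^k z + ζ_k(t))` with `ψ_k = Σ_{i<k} l_i t^{i+1}`, `ζ_k = −Σ_{i<k} γ_i t^{i+2}`; straightening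
`y ↦ y + ψ_k, z ↦ z + ζ_k` and the dilation `y ↦ t^k y, z ↦ t^k z` turn this into the weight condition of the FREE CHAIN
(`Literature.AlgebraicGeometry.Resolution.mem_pow_span_X_sup_maximalIdeal_pow_of_weight`), whence (`mem_span_pair_pow_sup_of_tTail`)
`g 0 ∈ (y − ψ_k, z − ζ_k)^p + 𝔪^{p+k}` for EVERY `k`; the approximate exit door (no `N₀` with `g 0 ∉ (u,v)^p + 𝔪^{N₀}` for all `u, v ∈ 𝔪`,
`…ApproximateExit.exists_forall_not_map_le_span_pair_pow_sup_mvPowerSeries` at the thread point) then gives `False` (`false_of_tTail`).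

HONEST FRAMING. OURS; nothing here is a statement of H. Hironaka's manuscript [Hironaka2017] and nothing of it is used. AI-written;
AI review is weaker than expert review. No `sorry`; axioms standard. [folklore] / [Hauser2010] §§F–G for the chart calculus.
-/

noncomputable section

set_option linter.dupNamespace false -- mandated namespace of this single-conjunct summit

open MvPowerSeries Finset IsLocalRing

namespace Summit.ResolutionOfSingularities.ResolutionOfSingularities.Theorems

namespace CampaignW46

namespace WWalk

variable {K : Type*} [Field K]

/-! ## §1 Polynomials in `t` and their invariance -/

/-- `tpoly c s n = Σ_{i<n} c_i · t^{s i + 1}` — a polynomial in `t` alone without constant term. [folklore] -/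
def tpoly (c : ℕ → K) (s : ℕ → ℕ) (n : ℕ) : MvPowerSeries (Option (Fin 2)) K :=
  ∑ i ∈ range n, C (c i) * X (some 0) ^ (s i + 1)

/-- `tpoly` at `n + 1`. [folklore] -/
theorem tpoly_succ (c : ℕ → K) (s : ℕ → ℕ) (n : ℕ) :
    tpoly c s (n + 1) = tpoly c s n + C (c n) * X (some 0) ^ (s n + 1) := by
  rw [tpoly, tpoly, sum_range_succ]

/-- `tpoly … 0 = 0`. [folklore] -/
theorem tpoly_zero (c : ℕ → K) (s : ℕ → ℕ) : tpoly c s 0 = 0 := by rw [tpoly, sum_range_zero]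

/-- A substitution fixing `t` fixes every `tpoly`. [folklore] -/
theorem subst_tpoly {a : Option (Fin 2) → MvPowerSeries (Option (Fin 2)) K} (ha : HasSubst a) (hat : a (some 0) = X (some 0))
    (c : ℕ → K) (s : ℕ → ℕ) (n : ℕ) : subst a (tpoly c s n) = tpoly c s n := by
  rw [tpoly, ← coe_substAlgHom ha, map_sum]
  refine sum_congr rfl fun i _ => ?_
  rw [map_mul, map_pow, coe_substAlgHom, subst_X ha, hat, subst_C]

/-- `tpoly` has constant coefficient `0`. [folklore] -/
theorem constantCoeff_tpoly (c : ℕ → K) (s : ℕ → ℕ) (n : ℕ) : constantCoeff (tpoly c s n) = 0 := by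
  rw [tpoly, map_sum]
  refine sum_eq_zero fun i _ => ?_
  rw [map_mul, map_pow, constantCoeff_X, zero_pow (Nat.succ_ne_zero _), mul_zero]

/-! ## §2 The substitution families of the endgame -/

/-- One `T`-step with cleaning, as a single substitution: `t ↦ t`, `y ↦ t(y + l)`, `z ↦ t(z − γt)`. [cite: Hauser2010, §§F–G] -/
def stepS (l γ : K) : Option (Fin 2) → MvPowerSeries (Option (Fin 2)) K :=
  fun o => Option.elim o (X (some 0) * (X none - C γ * X (some 0))) ![X (some 0), X (some 0) * (X (some 1) + C l)]

/-- The `k`-fold composite: `t ↦ t`, `y ↦ t^k y + ψ`, `z ↦ t^k z + ζ`. [folklore] -/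
def compS (k : ℕ) (ψ ζ : MvPowerSeries (Option (Fin 2)) K) : Option (Fin 2) → MvPowerSeries (Option (Fin 2)) K :=
  fun o => Option.elim o (X (some 0) ^ k * X none + ζ) ![X (some 0), X (some 0) ^ k * X (some 1) + ψ]

/-- The straightening `t ↦ t`, `y ↦ y + ψ`, `z ↦ z + ζ`. [folklore] -/
def straightS (ψ ζ : MvPowerSeries (Option (Fin 2)) K) : Option (Fin 2) → MvPowerSeries (Option (Fin 2)) K :=
  fun o => Option.elim o (X none + ζ) ![X (some 0), X (some 1) + ψ]

/-- The dilation `t ↦ t`, `y ↦ t^k y`, `z ↦ t^k z`. [folklore] -/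
def dilS (k : ℕ) : Option (Fin 2) → MvPowerSeries (Option (Fin 2)) K :=
  fun o => Option.elim o (X (some 0) ^ k * X none) ![X (some 0), X (some 0) ^ k * X (some 1)]

section simpLemmas
variable (l γ : K) (k : ℕ) (ψ ζ : MvPowerSeries (Option (Fin 2)) K)
/-- Value (simp). [folklore] -/ @[simp] theorem stepS_none : stepS l γ none = X (some 0) * (X none - C γ * X (some 0)) := rfl
/-- Value (simp). [folklore] -/ @[simp] theorem stepS_zero : stepS l γ (some 0) = X (some 0) := rfl
/-- Value (simp). [folklore] -/ @[simp] theorem stepS_one : stepS l γ (some 1) = X (some 0) * (X (some 1) + C l) := rfl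
/-- Value (simp). [folklore] -/ @[simp] theorem compS_none : compS k ψ ζ none = X (some 0) ^ k * X none + ζ := rfl
/-- Value (simp). [folklore] -/ @[simp] theorem compS_zero : compS k ψ ζ (some 0) = X (some 0) := rfl
/-- Value (simp). [folklore] -/ @[simp] theorem compS_one : compS k ψ ζ (some 1) = X (some 0) ^ k * X (some 1) + ψ := rfl
/-- Value (simp). [folklore] -/ @[simp] theorem straightS_none : straightS ψ ζ none = X none + ζ := rfl
/-- Value (simp). [folklore] -/ @[simp] theorem straightS_zero : straightS ψ ζ (some 0) = X (some 0) := rfl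
/-- Value (simp). [folklore] -/ @[simp] theorem straightS_one : straightS ψ ζ (some 1) = X (some 1) + ψ := rfl
/-- Value (simp). [folklore] -/ @[simp] theorem dilS_none : dilS (K := K) k none = X (some 0) ^ k * X none := rfl
/-- Value (simp). [folklore] -/ @[simp] theorem dilS_zero : dilS (K := K) k (some 0) = X (some 0) := rfl
/-- Value (simp). [folklore] -/ @[simp] theorem dilS_one : dilS (K := K) k (some 1) = X (some 0) ^ k * X (some 1) := rfl
end simpLemmas

/-- A family given by `Option.elim` with constant coefficients `0` is substitutable. [folklore] -/
theorem hasSubst_of_three {a : Option (Fin 2) → MvPowerSeries (Option (Fin 2)) K} (h0 : constantCoeff (a none) = 0)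
    (h1 : constantCoeff (a (some 0)) = 0) (h2 : constantCoeff (a (some 1)) = 0) : HasSubst a := by
  refine hasSubst_of_constantCoeff_zero fun o => ?_
  rcases o with _ | ⟨i, hi⟩
  · exact h0
  · interval_cases i
    · exact h1
    · exact h2

/-- `stepS` is substitutable. [folklore] -/
theorem hasSubst_stepS (l γ : K) : HasSubst (stepS l γ) :=
  hasSubst_of_three (by simp) (by simp) (by simp)

/-- `compS` is substitutable when `ψ(0) = ζ(0) = 0`. [folklore] -/
theorem hasSubst_compS (k : ℕ) {ψ ζ : MvPowerSeries (Option (Fin 2)) K} (hψ : constantCoeff ψ = 0) (hζ : constantCoeff ζ = 0) :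
    HasSubst (compS k ψ ζ) :=
  hasSubst_of_three (by simp [hζ]) (by simp) (by simp [hψ])

/-- `straightS` is substitutable when `ψ(0) = ζ(0) = 0`. [folklore] -/
theorem hasSubst_straightS {ψ ζ : MvPowerSeries (Option (Fin 2)) K} (hψ : constantCoeff ψ = 0) (hζ : constantCoeff ζ = 0) :
    HasSubst (straightS ψ ζ) :=
  hasSubst_of_three (by simp [hζ]) (by simp) (by simp [hψ])

/-- `dilS` is substitutable. [folklore] -/
theorem hasSubst_dilS (k : ℕ) : HasSubst (dilS (K := K) k) :=
  hasSubst_of_three (by simp) (by simp) (by simp)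

/-! ## §3 One step: `stepS = shearS ∘ thetaT`, and its effect on the generator -/

/-- `subst (stepS l γ) = subst (shearS γ) ∘ subst (thetaT l)`. [folklore] -/
theorem subst_stepS_eq (l γ : K) (h : MvPowerSeries (Option (Fin 2)) K) :
    subst (stepS l γ) h = subst (shearS γ) (subst (thetaT l) h) := by
  rw [subst_comp_subst_apply (hasSubst_thetaT l) (hasSubst_shearS γ)]
  congr 1
  funext o
  rcases o with _ | ⟨i, hi⟩
  · rw [thetaT_none, subst_mul (hasSubst_shearS γ), subst_X (hasSubst_shearS γ), subst_X (hasSubst_shearS γ), shearS_zero,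
      shearS_none, stepS_none]
  · interval_cases i
    · change stepS l γ (some 0) = subst (shearS γ) (thetaT l (some 0))
      rw [thetaT_zero, subst_X (hasSubst_shearS γ), shearS_zero, stepS_zero]
    · change stepS l γ (some 1) = subst (shearS γ) (thetaT l (some 1))
      rw [thetaT_one, subst_mul (hasSubst_shearS γ), subst_add (hasSubst_shearS γ), subst_X (hasSubst_shearS γ),
        subst_X (hasSubst_shearS γ), subst_C, shearS_zero, shearS_one, stepS_one]

/-- **One `T`-step on the generator**: `(z^p + f)(t, t(y+l), t(z − γt)) = t^p · (z^p + stepT p l γ f)` for `f` of order `≥ p`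
(characteristic `p`). [cite: Hauser2010, §§F–G] -/
theorem subst_stepS_generator {p : ℕ} [Fact p.Prime] [CharP K p] (l γ : K) {f : MvPowerSeries (Option (Fin 2)) K}
    (hf : LowVanish p f) : subst (stepS l γ) (X none ^ p + f) = X (some 0) ^ p * (X none ^ p + stepT p l γ f) := by
  rw [subst_stepS_eq, subst_thetaT_generator l hf, subst_mul (hasSubst_shearS γ), subst_pow (hasSubst_shearS γ),
    subst_X (hasSubst_shearS γ), shearS_zero, subst_shearS_generator]

/-! ## §4 The composite of `k` steps -/

/-- **Composition**: one more step after the `k`-fold composite is the `(k+1)`-fold composite with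
`ψ′ = ψ + l t^{k+1}`, `ζ′ = ζ − γ t^{k+2}` (for `ψ, ζ` fixed by substitutions fixing `t`). [folklore] -/
theorem subst_stepS_subst_compS (l γ : K) (k : ℕ) {ψ ζ : MvPowerSeries (Option (Fin 2)) K} (hψ : constantCoeff ψ = 0)
    (hζ : constantCoeff ζ = 0) (hψfix : subst (stepS l γ) ψ = ψ) (hζfix : subst (stepS l γ) ζ = ζ)
    (h : MvPowerSeries (Option (Fin 2)) K) :
    subst (stepS l γ) (subst (compS k ψ ζ) h) =
      subst (compS (k + 1) (ψ + C l * X (some 0) ^ (k + 1)) (ζ - C γ * X (some 0) ^ (k + 2))) h := by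
  rw [subst_comp_subst_apply (hasSubst_compS k hψ hζ) (hasSubst_stepS l γ)]
  congr 1
  funext o
  have hS := hasSubst_stepS l γ
  rcases o with _ | ⟨i, hi⟩
  · rw [compS_none, compS_none, subst_add hS, subst_mul hS, subst_pow hS, subst_X hS, subst_X hS, stepS_zero, stepS_none, hζfix]
    ring
  · interval_cases i
    · change subst (stepS l γ) (compS k ψ ζ (some 0)) = compS (k + 1) _ _ (some 0)
      rw [compS_zero, compS_zero, subst_X hS, stepS_zero]
    · change subst (stepS l γ) (compS k ψ ζ (some 1)) = compS (k + 1) _ _ (some 1)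
      rw [compS_one, compS_one, subst_add hS, subst_mul hS, subst_pow hS, subst_X hS, subst_X hS, stepS_zero, stepS_one, hψfix]
      ring

/-- The `ψ` and `ζ` of the walk: `ψ_k = Σ_{i<k} l_i t^{i+1}`, `ζ_k = Σ_{i<k} (−γ_i) t^{i+2}`. [folklore] -/
def psiT (l : ℕ → K) (k : ℕ) : MvPowerSeries (Option (Fin 2)) K := tpoly l (fun i => i) k

/-- See `psiT`. [folklore] -/
def zetaT (γ : ℕ → K) (k : ℕ) : MvPowerSeries (Option (Fin 2)) K := tpoly (fun i => -γ i) (fun i => i + 1) k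

/-- **THE COMPOSITE FORMULA**: along a `T`-tail, `t^{kp} · g k = (g 0)(t, t^k y + ψ_k, t^k z + ζ_k)`. [cite: Hauser2010, §F] -/
theorem tPow_mul_eq_subst_compS {p : ℕ} (g : ℕ → MvPowerSeries (Option (Fin 2)) K) (l γ : ℕ → K)
    (hstep : ∀ j, X (some 0) ^ p * g (j + 1) = subst (stepS (l j) (γ j)) (g j)) (k : ℕ) :
    X (some 0) ^ (k * p) * g k = subst (compS k (psiT l k) (zetaT γ k)) (g 0) := by
  induction k with
  | zero =>
    rw [zero_mul, pow_zero, one_mul]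
    have : compS 0 (psiT l 0) (zetaT γ 0) = (X : Option (Fin 2) → MvPowerSeries (Option (Fin 2)) K) := by
      funext o
      rcases o with _ | ⟨i, hi⟩
      · rw [compS_none, zetaT, tpoly_zero, pow_zero, one_mul, add_zero]
      · interval_cases i
        · rfl
        · change compS 0 (psiT l 0) (zetaT γ 0) (some 1) = X (some 1)
          rw [compS_one, psiT, tpoly_zero, pow_zero, one_mul, add_zero]
    rw [this, subst_self]; rfl
  | succ k ih =>
    have hS := hasSubst_stepS (l k) (γ k)
    have hψ : constantCoeff (psiT l k) = 0 := constantCoeff_tpoly _ _ _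
    have hζ : constantCoeff (zetaT γ k) = 0 := constantCoeff_tpoly _ _ _
    calc X (some 0) ^ ((k + 1) * p) * g (k + 1)
        = X (some 0) ^ (k * p) * (X (some 0) ^ p * g (k + 1)) := by ring
      _ = X (some 0) ^ (k * p) * subst (stepS (l k) (γ k)) (g k) := by rw [hstep]
      _ = subst (stepS (l k) (γ k)) (X (some 0) ^ (k * p) * g k) := by
          rw [subst_mul hS, subst_pow hS, subst_X hS, stepS_zero]
      _ = subst (stepS (l k) (γ k)) (subst (compS k (psiT l k) (zetaT γ k)) (g 0)) := by rw [ih]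
      _ = subst (compS (k + 1) (psiT l (k + 1)) (zetaT γ (k + 1))) (g 0) := by
          rw [subst_stepS_subst_compS (l k) (γ k) k hψ hζ (subst_tpoly hS rfl _ _ _) (subst_tpoly hS rfl _ _ _)]
          congr 2
          · rw [psiT, psiT, tpoly_succ]
          · rw [zetaT, zetaT, tpoly_succ, map_neg]; ring

/-! ## §5 Straightening and dilation; the weight condition -/

/-- `compS k ψ ζ = dilS k ∘ straightS ψ ζ` on series (for `ψ, ζ` polynomials in `t`). [folklore] -/
theorem subst_dilS_subst_straightS (k : ℕ) {ψ ζ : MvPowerSeries (Option (Fin 2)) K} (hψ : constantCoeff ψ = 0)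
    (hζ : constantCoeff ζ = 0) (hψfix : subst (dilS (K := K) k) ψ = ψ) (hζfix : subst (dilS (K := K) k) ζ = ζ)
    (h : MvPowerSeries (Option (Fin 2)) K) :
    subst (dilS k) (subst (straightS ψ ζ) h) = subst (compS k ψ ζ) h := by
  have hD := hasSubst_dilS (K := K) k
  rw [subst_comp_subst_apply (hasSubst_straightS hψ hζ) hD]
  congr 1
  funext o
  rcases o with _ | ⟨i, hi⟩
  · rw [straightS_none, compS_none, subst_add hD, subst_X hD, dilS_none, hζfix]
  · interval_cases i
    · change subst (dilS k) (straightS ψ ζ (some 0)) = compS k ψ ζ (some 0)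
      rw [straightS_zero, compS_zero, subst_X hD, dilS_zero]
    · change subst (dilS k) (straightS ψ ζ (some 1)) = compS k ψ ζ (some 1)
      rw [straightS_one, compS_one, subst_add hD, subst_X hD, dilS_one, hψfix]

/-- Un-straightening: `straightS (−ψ) (−ζ)` undoes `straightS ψ ζ`. [folklore] -/
theorem subst_straightS_neg_subst_straightS {ψ ζ : MvPowerSeries (Option (Fin 2)) K} (hψ : constantCoeff ψ = 0)
    (hζ : constantCoeff ζ = 0) (hψfix : subst (straightS (-ψ) (-ζ)) ψ = ψ) (hζfix : subst (straightS (-ψ) (-ζ)) ζ = ζ)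
    (h : MvPowerSeries (Option (Fin 2)) K) :
    subst (straightS (-ψ) (-ζ)) (subst (straightS ψ ζ) h) = h := by
  have hN : HasSubst (straightS (-ψ) (-ζ)) := hasSubst_straightS (by rw [map_neg, hψ, neg_zero]) (by rw [map_neg, hζ, neg_zero])
  rw [subst_comp_subst_apply (hasSubst_straightS hψ hζ) hN]
  have : (fun s => subst (straightS (-ψ) (-ζ)) (straightS ψ ζ s)) = (X : Option (Fin 2) → MvPowerSeries (Option (Fin 2)) K) := by
    funext o
    rcases o with _ | ⟨i, hi⟩
    · rw [straightS_none, subst_add hN, subst_X hN, straightS_none, hζfix]; ring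
    · interval_cases i
      · change subst (straightS (-ψ) (-ζ)) (straightS ψ ζ (some 0)) = X (some 0)
        rw [straightS_zero, subst_X hN, straightS_zero]
      · change subst (straightS (-ψ) (-ζ)) (straightS ψ ζ (some 1)) = X (some 1)
        rw [straightS_one, subst_add hN, subst_X hN, straightS_one, hψfix]; ring
  rw [this, subst_self]; rfl

/-- **Coefficients of a dilation** (single monomial): `[t^a y^b z^c] G(t, t^k y, t^k z) = [t^{a − k(b+c)} y^b z^c] G` if
`k(b+c) ≤ a`, else `0`. [folklore] -/
theorem coeff_subst_dilS (k : ℕ) (G : MvPowerSeries (Option (Fin 2)) K) (a b c : ℕ) :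
    coeff (mk3 a b c) (subst (dilS k) G) = if k * (b + c) ≤ a then coeff (mk3 (a - k * (b + c)) b c) G else 0 := by
  classical
  have hP : ∀ d : Option (Fin 2) →₀ ℕ, (d.prod fun s n => dilS (K := K) k s ^ n) =
      monomial (mk3 (d (some 0) + k * (d (some 1) + d none)) (d (some 1)) (d none)) 1 := by
    intro d
    rw [prod_pow_eq, dilS_zero, dilS_one, dilS_none, ← C_mul_X_pow_eq_monomial, map_one, one_mul, mul_pow, mul_pow, ← pow_mul,
      ← pow_mul, mul_add, pow_add, pow_add]
    ring
  rw [coeff_subst_eq_sum (hasSubst_dilS k) G (mk3 a b c) {mk3 (a - k * (b + c)) b c}]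
  · rw [sum_singleton, hP, coeff_monomial, smul_eq_mul]
    simp only [mk3_t, mk3_y, mk3_z]
    by_cases hle : k * (b + c) ≤ a
    · rw [if_pos hle, if_pos (mk3_inj.mpr ⟨by omega, rfl, rfl⟩), mul_one]
    · rw [if_neg hle, if_neg (fun h => hle (by have := (mk3_inj.mp h).1; omega)), mul_zero]
  · intro d hd
    rw [hP, coeff_monomial] at hd
    rw [mem_singleton]
    by_cases h : mk3 a b c = mk3 (d (some 0) + k * (d (some 1) + d none)) (d (some 1)) (d none)
    · obtain ⟨h1, h2, h3⟩ := mk3_inj.mp h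
      conv_lhs => rw [← mk3_eta d]
      exact mk3_inj.mpr ⟨by rw [h1, ← h2, ← h3]; omega, h2.symm, h3.symm⟩
    · rw [if_neg h, smul_zero] at hd; exact absurd rfl hd

/-- **The weight condition of the free chain** from the composite formula: if `G(t, t^k y, t^k z) = t^{kp} · g` with `ord g ≥ p`,
then every monomial `t^a y^b z^c` of `G` has `a + (k+1)(b+c) ≥ (k+1)p`. [folklore] -/
theorem weight_of_subst_dilS_eq {p : ℕ} (k : ℕ) {G g : MvPowerSeries (Option (Fin 2)) K}
    (hG : subst (dilS k) G = X (some 0) ^ (k * p) * g) (hg : LowVanish p g) (e : Option (Fin 2) →₀ ℕ) (he : coeff e G ≠ 0) :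
    (k + 1) * p ≤ e (some 0) + (k + 1) * (e.degree - e (some 0)) := by
  classical
  set a := e (some 0); set b := e (some 1); set c := e none
  have hdeg : e.degree - a = b + c := by rw [degree_eq]; omega
  rw [hdeg]
  have h1 : coeff (mk3 (a + k * (b + c)) b c) (subst (dilS k) G) = coeff e G := by
    rw [coeff_subst_dilS, if_pos (by omega), show a + k * (b + c) - k * (b + c) = a by omega, mk3_eta]
  rw [hG, X_pow_eq, coeff_monomial_mul] at h1
  by_cases hle : Finsupp.single (some 0) (k * p) ≤ mk3 (a + k * (b + c)) b c
  · rw [if_pos hle, one_mul] at h1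
    have hkp : k * p ≤ a + k * (b + c) := by have := hle (some 0); simpa using this
    have hsub : mk3 (a + k * (b + c)) b c - Finsupp.single (some 0) (k * p) = mk3 (a + k * (b + c) - k * p) b c := by
      ext o; rcases o with _ | ⟨i, hi⟩
      · simp [mk3]
      · interval_cases i <;> simp [mk3]
    rw [hsub] at h1
    have hne : coeff (mk3 (a + k * (b + c) - k * p) b c) g ≠ 0 := by rw [h1]; exact he
    have hdg : ¬ ((mk3 (a + k * (b + c) - k * p) b c).degree < p) := fun hlt => hne (hg _ hlt)
    rw [degree_mk3] at hdg
    push Not at hdg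
    -- `a + k(b+c) - kp + b + c ≥ p`
    have : (k + 1) * (b + c) = k * (b + c) + (b + c) := by ring
    have : (k + 1) * p = k * p + p := by ring
    omega
  · rw [if_neg hle] at h1
    exact absurd h1.symm he

/-! ## §6 The endgame -/

/-- **A `T`-TAIL PUTS THE GENERATOR INTO `(y − ψ_k, z − ζ_k)^p + 𝔪^{p+k}` FOR EVERY `k`.** [cite: Hauser2010, §§F–G; free chain
folklore as in `Literature.AlgebraicGeometry.Resolution.FreeChainApproximatePower`] -/
theorem mem_span_pair_pow_sup_of_tTail {p : ℕ} (g : ℕ → MvPowerSeries (Option (Fin 2)) K) (l γ : ℕ → K)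
    (hstep : ∀ j, X (some 0) ^ p * g (j + 1) = subst (stepS (l j) (γ j)) (g j)) (hord : ∀ j, LowVanish p (g j)) (k : ℕ) :
    g 0 ∈ Ideal.span {X (some 1) - psiT l k, X none - zetaT γ k} ^ p ⊔
      maximalIdeal (MvPowerSeries (Option (Fin 2)) K) ^ (p + k) := by
  classical
  set ψ := psiT l k with hψdef
  set ζ := zetaT γ k with hζdef
  have hψ : constantCoeff ψ = 0 := constantCoeff_tpoly _ _ _
  have hζ : constantCoeff ζ = 0 := constantCoeff_tpoly _ _ _
  have hN : HasSubst (straightS (-ψ) (-ζ)) := hasSubst_straightS (by rw [map_neg, hψ, neg_zero]) (by rw [map_neg, hζ, neg_zero])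
  -- the straightened generator and its weight condition
  set G := subst (straightS ψ ζ) (g 0) with hG
  have hcomp := tPow_mul_eq_subst_compS g l γ hstep k
  have hdil : subst (dilS k) G = X (some 0) ^ (k * p) * g k := by
    rw [hG, subst_dilS_subst_straightS k hψ hζ (subst_tpoly (hasSubst_dilS k) rfl _ _ _) (subst_tpoly (hasSubst_dilS k) rfl _ _ _),
      ← hcomp]
  have hweight := weight_of_subst_dilS_eq k hdil (hord k)
  -- the free chain
  have hfree := Literature.AlgebraicGeometry.Resolution.mem_pow_span_X_sup_maximalIdeal_pow_of_weight (some 0 : Option (Fin 2))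
    (p := p) (k := k) (G := G) hweight
  -- un-straighten with the algebra map `φ = subst (straightS (-ψ) (-ζ))`
  set φ : MvPowerSeries (Option (Fin 2)) K →ₐ[K] MvPowerSeries (Option (Fin 2)) K := substAlgHom hN with hφ
  have hφG : φ G = g 0 := by
    rw [hφ, substAlgHom_apply hN, hG]
    exact subst_straightS_neg_subst_straightS hψ hζ (subst_tpoly hN rfl _ _ _) (subst_tpoly hN rfl _ _ _) _
  rw [← hφG]
  have hmap : Ideal.map (φ : MvPowerSeries (Option (Fin 2)) K →+* MvPowerSeries (Option (Fin 2)) K)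
      (Ideal.span ((fun i => (X i : MvPowerSeries (Option (Fin 2)) K)) '' {i | i ≠ some 0}) ^ p ⊔
        maximalIdeal (MvPowerSeries (Option (Fin 2)) K) ^ (p + k)) ≤
      Ideal.span {X (some 1) - ψ, X none - ζ} ^ p ⊔ maximalIdeal (MvPowerSeries (Option (Fin 2)) K) ^ (p + k) := by
    rw [Ideal.map_sup]
    refine sup_le_sup ?_ ?_
    · rw [Ideal.map_pow, Ideal.map_span]
      refine Ideal.pow_right_mono (Ideal.span_le.mpr ?_) p
      rintro x ⟨y, ⟨i, hi, rfl⟩, rfl⟩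
      rcases i with _ | ⟨j, hj⟩
      · refine Ideal.subset_span (Or.inr ?_)
        change φ (X none) = X none - ζ
        rw [hφ, substAlgHom_apply hN, subst_X hN, straightS_none]; ring
      · interval_cases j
        · exact absurd rfl hi
        · refine Ideal.subset_span (Or.inl ?_)
          change φ (X (some 1)) = X (some 1) - ψ
          rw [hφ, substAlgHom_apply hN, subst_X hN, straightS_one]; ring
    · exact Ideal.map_le_iff_le_comap.mpr fun y hy =>
        Literature.RingTheory.MvPowerSeries.Jets.algHom_apply_mem_maximalIdeal_pow φ hy
  exact hmap (Ideal.mem_map_of_mem _ hfree)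

/-- **THE ENDGAME: NO INFINITE `T`-TAIL BEHIND THE DOOR.** If the generators `g j` (order `≥ p`) of a `T`-tail satisfy the step
relation and the approximate exit door holds at the start (`∃ N₀, ∀ u v ∈ 𝔪, g 0 ∉ (u, v)^p + 𝔪^{N₀}` — o1/pv-050's isolatedness read in
the completion, `…ApproximateExit`), then `False`. [cite: Hauser2010, §§F–G] -/
theorem false_of_tTail {p : ℕ} (g : ℕ → MvPowerSeries (Option (Fin 2)) K) (l γ : ℕ → K)
    (hstep : ∀ j, X (some 0) ^ p * g (j + 1) = subst (stepS (l j) (γ j)) (g j)) (hord : ∀ j, LowVanish p (g j))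
    (hdoor : ∃ N₀, ∀ u v : MvPowerSeries (Option (Fin 2)) K, u ∈ maximalIdeal (MvPowerSeries (Option (Fin 2)) K) →
      v ∈ maximalIdeal (MvPowerSeries (Option (Fin 2)) K) →
      g 0 ∉ Ideal.span {u, v} ^ p ⊔ maximalIdeal (MvPowerSeries (Option (Fin 2)) K) ^ N₀) : False := by
  obtain ⟨N₀, hN₀⟩ := hdoor
  have hmem := mem_span_pair_pow_sup_of_tTail g l γ hstep hord N₀
  have hle : Ideal.span {X (some 1) - psiT l N₀, X none - zetaT γ N₀} ^ p ⊔ maximalIdeal (MvPowerSeries (Option (Fin 2)) K) ^ (p + N₀) ≤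
      Ideal.span {X (some 1) - psiT l N₀, X none - zetaT γ N₀} ^ p ⊔ maximalIdeal (MvPowerSeries (Option (Fin 2)) K) ^ N₀ :=
    sup_le_sup_left (Ideal.pow_le_pow_right (Nat.le_add_left N₀ p)) _
  refine hN₀ _ _ ?_ ?_ (hle hmem)
  · rw [Literature.RingTheory.MvPowerSeries.Jets.mem_maximalIdeal_iff_constantCoeff_eq_zero, map_sub, constantCoeff_X, psiT,
      constantCoeff_tpoly, sub_zero]
  · rw [Literature.RingTheory.MvPowerSeries.Jets.mem_maximalIdeal_iff_constantCoeff_eq_zero, map_sub, constantCoeff_X, zetaT,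
      constantCoeff_tpoly, sub_zero]

end WWalk


end CampaignW46

end Summit.ResolutionOfSingularities.ResolutionOfSingularities.Theorems

end
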